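import Literature.Probability.LatticeModels.ThermodynamicLimit
import Mathlib.Data.Pi.Interval
import Mathlib.Data.Int.Interval
import Mathlib.Data.Finset.Sym
import HarnessLib

/-!
# Aizenman–Grimmett windows: counting the pairs of a box near a site

RSW3 lane (lead, gen 32).  Helper shared by the sieve line (`PercSieveRigidity.StrictPlugSieve`, stmt-CriticalPhenomena-7690 ⊇ 9592)
and the decorated-slab line (`PercSupergraphDichotomy.DecoratedSlabsSupercritical`, stmt-11901): the window-size bound entering
`AGLine.theta_line_mono`.  The windows `C_E(e) = C_V(e)` of the local modification are the pairs of `Λ_n` whose endpoints lie within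
sup-distance `R + 1` of the first endpoint of `e`; there are at most `((2R+3)^d + 1)²` of them (`card_CE_le`, via `card_cube` and
`card_filter_near_le`).  Def-free, graph-free.

References: S. Martineau, F. Severo, Ann. Probab. 47 (2019) §6 (the constant C) [MartineauSevero2019]; G. Grimmett, *Percolation*
(1999) §3.3 [GrimmettPercolation1999].
-/

namespace Summit.CriticalPhenomena.PercolationContinuityZ3.Theorems

namespace StrictPlugSieve

open Literature.Probability.LatticeModels
open scoped Classical

variable {d : ℕ}

/-- The sup-cube of radius `r` around `a` has `(2r+1)^d` sites. [folklore] -/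
theorem card_cube (a : Site d) (r : ℕ) :
    (Finset.Icc (fun j => a j - r) (fun j => a j + r) : Finset (Site d)).card = (2 * r + 1) ^ d := by
  rw [Pi.card_Icc]
  have h : ∀ j : Fin d, (Finset.Icc (a j - r) (a j + r)).card = 2 * r + 1 := fun j => by
    rw [Int.card_Icc]; omega
  simp only [h, Finset.prod_const, Finset.card_univ, Fintype.card_fin]

/-- Pairs with both endpoints in the sup-cube of radius `r` around `a`: at most `((2r+1)^d + 1)²`. [folklore] -/
theorem card_filter_near_le (T : Finset (Sym2 (Site d))) (a : Site d) (r : ℕ) :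
    (T.filter fun g => ∀ t ∈ g, ∀ j, |t j - a j| ≤ (r : ℤ)).card ≤ ((2 * r + 1) ^ d + 1) ^ 2 := by
  set cube : Finset (Site d) := Finset.Icc (fun j => a j - r) (fun j => a j + r) with hcube
  have hsub : (T.filter fun g => ∀ t ∈ g, ∀ j, |t j - a j| ≤ (r : ℤ)) ⊆ cube.sym2 := by
    intro g hg
    rw [Finset.mem_filter] at hg
    rw [Finset.mem_sym2_iff]
    intro t ht
    rw [hcube, Finset.mem_Icc]
    constructor <;> intro j <;> have := hg.2 t ht j <;> rw [abs_le] at this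
    · linarith [this.1]
    · linarith [this.2]
  refine (Finset.card_le_card hsub).trans ?_
  rw [Finset.card_sym2, card_cube, Nat.choose_two_right]
  set N : ℕ := (2 * r + 1) ^ d
  calc (N + 1) * (N + 1 - 1) / 2 ≤ (N + 1) * (N + 1 - 1) := Nat.div_le_self _ _
    _ ≤ (N + 1) ^ 2 := by rw [Nat.add_sub_cancel, sq]; exact Nat.mul_le_mul_left _ (Nat.le_succ N)

/-- **Size of the windows**: `#C_E(e) ≤ ((2R+3)^d + 1)²`. [folklore] -/
theorem card_CE_le (n R : ℕ) (e : Sym2 (Site d)) : (((box d n).sym2.filter fun e' => ∀ t ∈ e', ∀ j, |t j - (Quot.out (e : Sym2 (Site d))).1 j| ≤ ((R : ℕ) : ℤ) + 1)).card ≤ ((2 * (R + 1) +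
      1) ^ d + 1) ^ 2 := by
  have h := card_filter_near_le ((box d n).sym2) (Quot.out e).1 (R + 1)
  have hcast : (((R + 1 : ℕ)) : ℤ) = (R : ℤ) + 1 := by push_cast; ring
  rw [hcast] at h
  exact h

end StrictPlugSieve

end Summit.CriticalPhenomena.PercolationContinuityZ3.Theorems
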